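import Mathlib
import Summits.Ventures.PercRepro2.Defs
import Summits.Ventures.PercRepro2.Graph
import Summits.Ventures.PercRepro2.Harris
import Summits.Ventures.PercRepro2.Events
import Summits.Ventures.PercRepro2.Induced
import Summits.Ventures.PercRepro2.GateDefs
import Summits.Ventures.PercRepro2.GateFrame
import Summits.Ventures.PercRepro2.GateShift
import Summits.Ventures.PercRepro2.GateAnatomy
import Summits.Ventures.PercRepro2.ZMeanBound

/-!
# The free one-sided gate from a log-supermodular class-B mass (blind cell PercRepro2, mine-c g8;
MINE-C.md §15, proofs/MINEC-LSMGATE.md)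

Root `s`, avoided vertex `t`, markers `a, b`, gate vertices `u, w`; `A = R ∩ {w ∉ C(t)}`,
`B = {w ∈ C(t)} ∩ {s ↮ t, s ↮ u}` (`GateAnatomy.classA/classB`). `GateAnatomy.gateRow_of_within`
reduces the free gate `Gate.GateRow s {t} a b {u} {w}` to `0 ≤ P(B)·covA + P(A)·covB`.

* `covA ≥ 0` is the hull-frame positive association `Gate.hull_frame_pa` (`covC_classA_nonneg`).
* `covB ≥ 0` follows from the **FKG lattice condition in the root frame**: write the class-B mass
  as a function of the root cluster, `massB W = P(C(s) = W ∧ B)`; if `massB` is log-supermodular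
  on the distributive lattice `Finset V` (`MassBLogSupermod`), the four functions theorem gives
  `P(X; B) P(Y; B) ≤ P(B) P(XY; B)` for the increasing cluster events `X = {a ∈ C(s)}`,
  `Y = {b ∈ C(s)}` (`covC_classB_nonneg`).
* Hence `gateRow_of_massB_logSupermod`: `MassBLogSupermod → GateRow` (both classes of positive mass).

The hypothesis holds on every forest and, more generally, on every graph all of whose blocks are
edges or triangles (paper, proofs/MINEC-LSMGATE.md: the root-cluster law is log-modular on the
lattice of rooted subtrees and the conditional weight `P(w ↔ t | C(s) = W)·1[u, t ∉ W]` is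
log-supermodular there); on general graphs it fails exactly where `covB < 0` (exact census
n = 6 FULL: 5,272 / 103,680 instances on the 96 non-cactus graphs, 0 / 17,280 on the 16 cacti).
-/

namespace Summit.Ventures.PercRepro2

namespace GateLSM

variable {V : Type*} {E : Type*} [Fintype E] [DecidableEq E] [Fintype V] [DecidableEq V]
  {R : Type*} [Field R] [LinearOrder R] [IsStrictOrderedRing R]

variable (p : E → R) (ends : E → Sym2 V) (s t a b u w : V)

/-- The class-B mass of the root cluster `W`: `P(C(s) = W ∧ B)`. -/
noncomputable def massB (W : Finset V) : R :=
  prob p (clusterEvent ends s (↑W : Set V) ∩ GateAnatomy.classB ends s t u w)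

/-- **The FKG lattice condition for the class-B mass** on the distributive lattice `Finset V`:
`massB W₁ · massB W₂ ≤ massB (W₁ ∩ W₂) · massB (W₁ ∪ W₂)`. -/
def MassBLogSupermod : Prop :=
  ∀ W₁ W₂ : Finset V, massB p ends s t u w W₁ * massB p ends s t u w W₂ ≤
    massB p ends s t u w (W₁ ∩ W₂) * massB p ends s t u w (W₁ ∪ W₂)

variable {p}

omit [Fintype E] [DecidableEq E] [Fintype V] [Field R] [LinearOrder R] [IsStrictOrderedRing R] in
/-- On `{C(s) = W}` the event `{s ↔ x ∀ x ∈ X}` is decided by `W`. -/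
lemma clusterEvent_inter_connAll (W X : Finset V) (C : Set (Config E)) :
    clusterEvent ends s (↑W : Set V) ∩ (connAll ends s X ∩ C) =
      if X ⊆ W then clusterEvent ends s (↑W : Set V) ∩ C else ∅ := by
  split_ifs with h
  · ext ω
    simp only [Set.mem_inter_iff, mem_clusterEvent, connAll, Set.mem_setOf_eq]
    constructor
    · rintro ⟨hc, _, hC⟩; exact ⟨hc, hC⟩
    · rintro ⟨hc, hC⟩
      refine ⟨hc, fun x hx => ?_, hC⟩
      have : x ∈ cluster ends ω s := by rw [hc]; exact Finset.mem_coe.mpr (h hx)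
      exact this
  · ext ω
    simp only [Set.mem_inter_iff, mem_clusterEvent, connAll, Set.mem_setOf_eq, Set.mem_empty_iff_false,
      iff_false, not_and]
    intro hc hX _
    apply h
    intro x hx
    have : x ∈ cluster ends ω s := hX x hx
    rw [hc] at this
    exact Finset.mem_coe.mp this

omit [LinearOrder R] [IsStrictOrderedRing R] in
/-- `P(X; B) = Σ_W 1[X ⊆ W] · massB W`: the root-frame partition of a class-B marker mass. -/
lemma prob_connAll_inter_classB_eq_sum (X : Finset V) :
    prob p (connAll ends s X ∩ GateAnatomy.classB ends s t u w) =
      ∑ W : Finset V, (if X ⊆ W then massB p ends s t u w W else 0) := by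
  rw [prob_eq_sum_clusterEvent p ends s]
  refine Finset.sum_congr rfl fun W _ => ?_
  rw [clusterEvent_inter_connAll]
  unfold massB
  split_ifs <;> simp [prob]

omit [LinearOrder R] [IsStrictOrderedRing R] in
/-- `P(B) = Σ_W massB W`. -/
lemma prob_classB_eq_sum :
    prob p (GateAnatomy.classB ends s t u w) = ∑ W : Finset V, massB p ends s t u w W := by
  rw [prob_eq_sum_clusterEvent p ends s]
  rfl

/-- **Class B is positively associated under the FKG lattice condition**:
`0 ≤ covB = P(B) P(XY; B) − P(X; B) P(Y; B)` (four functions theorem on `Finset V`). -/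
theorem covC_classB_nonneg (hp : IsProbVec p) (h : MassBLogSupermod p ends s t u w) :
    0 ≤ GateAnatomy.covC p ends s a b (GateAnatomy.classB ends s t u w) := by
  classical
  unfold GateAnatomy.covC
  rw [sub_nonneg, prob_classB_eq_sum, prob_connAll_inter_classB_eq_sum,
    prob_connAll_inter_classB_eq_sum, prob_connAll_inter_classB_eq_sum]
  have hm0 : ∀ W, 0 ≤ massB p ends s t u w W := fun W => prob_nonneg hp _
  have hχ0 : ∀ (X W : Finset V), (0 : R) ≤ if X ⊆ W then massB p ends s t u w W else 0 :=
    fun X W => by split_ifs <;> simp [hm0]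
  refine four_functions_theorem_univ (fun W => if {a} ⊆ W then massB p ends s t u w W else 0)
    (fun W => if {b} ⊆ W then massB p ends s t u w W else 0) (fun W => massB p ends s t u w W)
    (fun W => if {a} ∪ {b} ⊆ W then massB p ends s t u w W else 0)
    (fun W => hχ0 _ W) (fun W => hχ0 _ W) hm0 (fun W => hχ0 _ W) ?_
  intro W₁ W₂
  by_cases ha : {a} ⊆ W₁
  · by_cases hb : {b} ⊆ W₂
    · have hab : {a} ∪ {b} ⊆ W₁ ⊔ W₂ :=
        Finset.union_subset (ha.trans Finset.subset_union_left) (hb.trans Finset.subset_union_right)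
      rw [if_pos ha, if_pos hb, if_pos hab]
      exact h W₁ W₂
    · rw [if_neg hb, mul_zero]
      exact mul_nonneg (hm0 _) (hχ0 _ _)
  · rw [if_neg ha, zero_mul]
    exact mul_nonneg (hm0 _) (hχ0 _ _)

omit [Fintype E] [DecidableEq E] [Fintype V] [DecidableEq V] [Field R] [LinearOrder R]
  [IsStrictOrderedRing R] in
/-- Class `A` is the hull frame `R ∩ {K avoids {w}}` of `Gate.hull_frame_pa`. -/
lemma classA_eq :
    GateAnatomy.classA ends s t w = avoidAll ends s {t} ∩ (Gate.hitsK ends {t} {w})ᶜ := by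
  ext ω
  simp [GateAnatomy.classA, Gate.hitsK, clusterInEvent]

/-- **Class A is positively associated** (hull-frame BHK): `0 ≤ covA`. -/
theorem covC_classA_nonneg (hp : IsProbVec p) :
    0 ≤ GateAnatomy.covC p ends s a b (GateAnatomy.classA ends s t w) := by
  unfold GateAnatomy.covC
  rw [sub_nonneg, classA_eq]
  have := Gate.hull_frame_pa p ends s {t} {w} a b hp
  linarith [this]

/-- **The free one-sided gate under the FKG lattice condition on the class-B mass**: if
`W ↦ P(C(s) = W ∧ B)` is log-supermodular on `Finset V` and both classes have positive mass, then
`Gate.GateRow s {t} a b {u} {w}`. (Forests and triangular cacti satisfy the hypothesis — paper.) -/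
theorem gateRow_of_massB_logSupermod (hp : IsProbVec p)
    (hA : 0 < prob p (GateAnatomy.classA ends s t w))
    (hB : 0 < prob p (GateAnatomy.classB ends s t u w))
    (h : MassBLogSupermod p ends s t u w) :
    Gate.GateRow p ends s {t} a b {u} {w} := by
  refine GateAnatomy.gateRow_of_within p ends s t a b u w hp hA hB ?_
  have h1 := covC_classA_nonneg ends s t a b w hp
  have h2 := covC_classB_nonneg ends s t a b u w hp h
  have hpa := prob_nonneg hp (GateAnatomy.classA ends s t w)
  have hpb := prob_nonneg hp (GateAnatomy.classB ends s t u w)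
  nlinarith [mul_nonneg hpb h1, mul_nonneg hpa h2]

end GateLSM

end Summit.Ventures.PercRepro2
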